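import Literature.AnabelianGeometry.AbsoluteAnabelian.AbsTopIII.KummerFaithfulProfiniteProofs
import Literature.AlgebraicGeometry.Motives.AlgPointsTotallyDisconnectedProofs
import Literature.AlgebraicGeometry.Motives.AbelianVarietyComplexPoints
import Mathlib.Analysis.Normed.Unbundled.SpectralNorm
import Mathlib.Analysis.Normed.Module.FiniteDimension
import Mathlib.NumberTheory.Padics.ProperSpace
import Mathlib.Topology.MetricSpace.Ultra.TotallySeparated
import HarnessLib

/-!
# [AbsTopIII] Rmk. 1.5.4 (i): no divisible points on PROPER GROUP SCHEMES over `p`-adic fields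

Proof-only companion (no new definitions) to `AbsTopIII/KummerFaithful.lean` (S. Mochizuki, *Topics in
Absolute Anabelian Geometry III*, §1, Def. 1.5 p. 32, Rmk. 1.5.4 (i) p. 33, lit key
`paper:url-5493eb38cbb7`): "if `k` [...] is a finite extension of `ℚ_p`, then `A(k_H)` is [...] a
compact abelian `p`-adic Lie group [...]. In particular, the condition of Definition 1.5, (a), is
satisfied."

The tree proves condition (a) for ABELIAN VARIETIES over finite extensions of `ℚ_p`
(`AbelianVariety.divisibleElementsTrivial_points_of_finite_padic`, companion
`KummerFaithfulPadicAbelianProofs`).  This file records the same argument for an ARBITRARY PROPER GROUP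
SCHEME `G` over such a field (no commutativity, no geometric integrality): `G(K)` with its strong
topology is a compact, Hausdorff, totally disconnected topological group (tree:
`compactSpace_t2Space_totallyDisconnectedSpace_algPoints_of_isProper`, `AlgPoints.isTopologicalGroup`),
hence an element with `n`-th roots for every `n ≥ 1` is trivial
(`eq_one_of_forall_exists_pow_eq_of_profinite`, companion `KummerFaithfulProfiniteProofs`).

* `AlgPoints.eq_one_of_forall_exists_pow_eq_of_isProper` — over any locally compact, totally
  disconnected, non-trivially normed field `K`;
* `AlgPoints.eq_one_of_forall_exists_pow_eq_of_finite_padic` — over a bare finite extension `K` of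
  `ℚ_p` (the spectral norm supplies the topology inside the proof; the statement is topology-free).

WHY (route memo HOME/staging/f/f-083/g2/F0369-FG-ROUTE.md, step 5): in the closed-point induction for
the remaining open part of FACT-LIST row F-0369 (`Rmk_1_5_4_i` over finitely generated extensions of
`ℚ_p` of positive transcendence degree), the special fibres of the proper smooth group scheme
furnished by the tree's `exists_abelianScheme_away_holds` are proper group schemes over MLF's that are
NOT known to be geometrically integral without a Zariski-connectedness step; for transcendence degree
one this lemma is exactly the base case that makes that step unnecessary.  Classical; nothing here
bears on [IUTchIII] Cor. 3.12; typed ≠ discharged.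
-/

noncomputable section

open CategoryTheory AlgebraicGeometry
open scoped MonObj Classical

universe u

namespace Literature.AlgebraicGeometry.Motives.AlgPoints

/-- **No divisible points on a proper group scheme over a totally disconnected local field.**  For a
group scheme `G` proper over a locally compact, totally disconnected, non-trivially normed field `K`
(e.g. a finite extension of `ℚ_p`), an element of `G(K)` admitting an `n`-th root for every `n ≥ 1`
is the identity: `G(K)` is a compact Hausdorff totally disconnected topological group, i.e. profinite,
and the open normal subgroups of finite index separate points ([AbsTopIII] Rmk. 1.5.4 (i) p. 33,
condition (a) of Def. 1.5, for `G` in place of an abelian variety; no commutativity or connectedness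
is used). [cite: MochizukiAbsTopIII2015, Rmk 1.5.4 (i) p.33] -/
theorem eq_one_of_forall_exists_pow_eq_of_isProper {K : Type u} [NontriviallyNormedField K]
    [LocallyCompactSpace K] [TotallyDisconnectedSpace K] (G : SchemeOver K) [GrpObj G]
    [IsProper G.hom] (x : AlgPoints G K) (hx : ∀ n : ℕ, 0 < n → ∃ y : AlgPoints G K, y ^ n = x) :
    x = 1 := by
  obtain ⟨hc, ht2, htd⟩ :=
    compactSpace_t2Space_totallyDisconnectedSpace_algPoints_of_isProper (k := K) G K
  haveI := hc
  haveI := ht2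
  haveI := htd
  haveI : IsTopologicalGroup (AlgPoints G K) := AlgPoints.isTopologicalGroup
  exact Literature.AnabelianGeometry.AbsoluteAnabelian.AbsTopIII.eq_one_of_forall_exists_pow_eq_of_profinite
    x hx

/-- **No divisible points on a proper group scheme over a finite extension of `ℚ_p`** (bare field
`K`, no topology in the statement): equip `K` with the spectral norm extending `‖·‖_p` (Mathlib
`spectralNorm.normedField`; non-trivial as `‖p‖ < 1`, ultrametric hence totally disconnected, locally
compact as a finite-dimensional normed `ℚ_p`-space) and apply
`eq_one_of_forall_exists_pow_eq_of_isProper`.  ([AbsTopIII] Rmk. 1.5.4 (i) p. 33, condition (a) of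
Def. 1.5 for an arbitrary proper group scheme over an MLF.) [cite: MochizukiAbsTopIII2015, Rmk 1.5.4 (i) p.33] -/
theorem eq_one_of_forall_exists_pow_eq_of_finite_padic (p : ℕ) [Fact p.Prime] (K : Type u) [Field K]
    [Algebra ℚ_[p] K] [Module.Finite ℚ_[p] K] (G : SchemeOver K) [GrpObj G] [IsProper G.hom]
    (x : AlgPoints G K) (hx : ∀ n : ℕ, 0 < n → ∃ y : AlgPoints G K, y ^ n = x) : x = 1 := by
  haveI : Algebra.IsAlgebraic ℚ_[p] K := Algebra.IsAlgebraic.of_finite ℚ_[p] K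
  letI : NormedField K := spectralNorm.normedField ℚ_[p] K
  have hnorm : ∀ z : K, ‖z‖ = spectralNorm ℚ_[p] K z := fun _ => rfl
  have hp : ∃ z : K, z ≠ 0 ∧ ‖z‖ ≠ 1 := by
    refine ⟨algebraMap ℚ_[p] K p, ?_, ?_⟩
    · exact (map_ne_zero _).mpr (by exact_mod_cast (Fact.out : p.Prime).ne_zero)
    · rw [hnorm, spectralNorm_extends]
      exact (Padic.norm_p_lt_one (p := p)).ne
  letI : NontriviallyNormedField K := NontriviallyNormedField.ofNormNeOne hp
  letI : NormedSpace ℚ_[p] K := spectralNorm.normedSpace ℚ_[p] K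
  haveI : ProperSpace K := FiniteDimensional.proper ℚ_[p] K
  haveI : IsUltrametricDist K :=
    IsUltrametricDist.isUltrametricDist_of_forall_norm_add_le_max_norm
      (fun a b => isNonarchimedean_spectralNorm a b)
  exact eq_one_of_forall_exists_pow_eq_of_isProper G x hx

end Literature.AlgebraicGeometry.Motives.AlgPoints
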